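import Summits.QuantumFields.YangMills.Theorems.BalabanUVNodesN18KingModelDensTorus
import Literature.MathematicalPhysics.QuantumFieldTheory.Balaban1983to89.T4MatchingAssembly

/-!
# BalabanUVNodes ∕ node N18 (NE5 bracket) → N19 → apex: KING'S SMALL-FIELD GAUSSIAN MODEL INHABITS THE SPINE'S NE7 ASSEMBLY END TO END — the consecutive runs' dressed
# small-field partition functions on the unit torus satisfy `HybridNE7` (no large-field classes, no shells, `Core` from DENS_cl⁰), hence NE7 `MatchingModConstants` with a SUMMABLE
# remainder, and the generating functions `log Z_K(t) − log Z_K(0)` of every bounded unit-scale observable are CAUCHY in the run length `K`, uniformly on the source window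

Cell `pub-ymgap`, HUMAN RULING D-0062 (Track A), R134 ACCELERATION seat `pub-ymgap-dag-n14-c` re-pointed to **N18-b** (dag-lead REBALANCE №67), generation 6, third N18 module;
route `Summits/QuantumFields/YangMills/Theses/BalabanUVNodes.lean` rev 18∕19 (cluster K3⁗ `SpineGivenEndpointR13Sep` = stmt-QuantumFields-20292, `--supports … --as helper`); venue
ruling R424 (`YangMills/Theorems`, namespace `YMDAG.N18.KingModelCauchy`).  ADDITIVE — imports this seat's `…N18KingModelDensTorus` (DENS_cl⁰ at King's unit-torus effective
Laplacians, `abs_action_sub_le_torus_of_eq`, the small-field box lemmas, `core_of_actionBound`) and the tree's `T4MatchingAssembly` (★ `HybridNE7`, `hybridNE7_noShell`,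
`HybridNE7.cauchy` — the NE7 assembly of record and its Cauchy conclusion; `T4WeightBudget.RelWeightBound`, `T4CauchySum.MatchingModConstants ∕ genFun ∕ genFunLim`) — all CITED;
THEOREMS ONLY (0 `def`), modifies nothing.

WHAT THIS FILE PROVES.  Fix King's data `a > 0`, `m² > 0`, `L ≥ 2`, a unit torus `Π ℤ/M_μ`, a small-field radius `R > 0` and ONE bounded measurable unit-scale observable
`W : (Tor M → ℝ) → ℝ` (`|W| ≤ B`).  Run length `K` ↦ the dressed small-field partition function
`Z K t = ∫_{|φ(x)| ≤ R} exp(−½φ·Δ^{(K+1)}φ)·e^{tW(φ)} dφ` of the Gaussian effective measure after `K + 1` block-averaging steps (`Δ^{(K+1)} = Torus.effLaplacian (L^{K+1}) M a_{K+1}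
((L^{K+1})²) m²`).  Then:
* §1 [folklore] `relWeightBound_empty` (NO large-field classes: NE7b's `RelWeightBound` with `Bad = ∅`, `W = 0`); `integrand_pos`, `integrable_integrand`, `dressedZ_pos` (the dressed
  small-field partition function is POSITIVE: positive integrand on a box of positive volume), `volume_smallField_pos`.
* §2 [folklore ∘ `KingModelDensTorus`] ★ `core_kingSmallField_consecutive` (`Spine.NE7.Core` for `P K = Z K`, `Q K = Z (K+1)` — run B IS run A one level up: `L^{K+2} = L·L^{K+1}`,
  `abs_action_sub_le_torus_of_eq` — with `vol·δ_K ≥ θ_{K+1}·a·R²|Tor M|/2`).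
* §3 [folklore ∘ §1–§2 + `T4MatchingAssembly`] ★★ **`hybridNE7_kingSmallField`** (the spine's NE7 assembly `HybridNE7 l₀ vol T Z Z′ ∅ 0 0 0 0 δ` INHABITED with the geometric
  `δ_K = θ_{K+1}·a·R²|Tor M|/(2vol)`), ★★★ **`cauchy_genFun_kingSmallField`**: `MatchingModConstants vol l₀ δ Z ∧ Summable δ ∧ (∀ |t| ≤ l₀, CauchySeq (K ↦ genFun Z K t)) ∧
  TendstoUniformlyOn (genFun Z) (genFunLim Z) atTop {|t| ≤ l₀}` — N19's `Target` and the apex's Cauchy property of the generating functions, IN THE PRINTED MODEL, by `HybridNE7.cauchy`.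

HONEST FRAMING.  King's `A = 0` scalar MODEL, periodic boundary conditions, `m² > 0`, SMALL-FIELD CLASSES ONLY (the large-field classes of King's Thm 3.1 expansion — `Bad` — are EMPTY
here by fiat; King's own continuum limit Thm 2.1∕3.4 handles them by his T_K(χ) expansion, NOT reproduced): a printed-model inhabitant of the spine's NE7 → apex road with every
hypothesis discharged except the model's data — template literature, NOT Bałaban's non-abelian densities (NE7 proper NOT PRINTED there; NODE O ∕ U3 objects); count-neutral;
N18 ∕ N19 ∕ N27 NOT discharged; counts UNMOVED.  Everything is PROVED (0 `sorry`, 0 named facts).  One finite four-torus programme at fixed ε; NOT ℝ⁴, NOT OS, NOT a mass gap,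
NOT Clay.
-/

noncomputable section

namespace YMDAG.N18.KingModelCauchy

open MeasureTheory Set Filter Finset Real Matrix Topology
open scoped ENNReal BigOperators
open Summit.QuantumFields.BalabanUV.T4Continuum.Spine.NE7 (Core)
open YMDAG.N18.KingModelDens (kingTheta_nonneg summable_kingRadius)
open YMDAG.N18.KingModelDensTorus (core_of_actionBound abs_action_sub_le_torus_of_eq measurable_dotProduct_mulVec dotProduct_effLaplacian_nonneg smallField_eq_Icc
  volume_smallField_lt_top ae_dotProduct_le_smallField)
open Literature.MathematicalPhysics.QuantumFieldTheory.King1986 (aK thetaK aK_pos)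
open Literature.MathematicalPhysics.QuantumFieldTheory.King1986.Torus (effLaplacian)
open Literature.MathematicalPhysics.QuantumFieldTheory.Balaban1983to89.B5Prop11Plancherel (Tor)
open Literature.MathematicalPhysics.QuantumFieldTheory.Balaban1983to89.T4WeightBudget (RelWeightBound)
open Literature.MathematicalPhysics.QuantumFieldTheory.Balaban1983to89.T4MatchingAssembly (HybridNE7 hybridNE7_noShell)
open Literature.MathematicalPhysics.QuantumFieldTheory.Balaban1983to89.T4CauchySum (MatchingModConstants genFun genFunLim)
open Literature.MathematicalPhysics.QuantumFieldTheory.Balaban1983to89.T4HybridMatching (hybridDelta)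

/-! ## §1 No large-field classes; positivity of the dressed small-field partition function -/
section Weights

/-- **NE7b WITH NO LARGE-FIELD CLASSES** [folklore]: `Bad = ∅`, relative weight `0` — `RelWeightBound l₀ T A B (∅) (0)` for ANY class families. -/
theorem relWeightBound_empty {ι : Type*} {l₀ : ℝ} {T : ℕ → Finset ι} {A B : ℕ → ℝ → ι → ℝ} :
    RelWeightBound l₀ T A B (fun _ _ => ∅) (fun _ => 0) where
  bad_subset _ _ _ := Finset.empty_subset _
  nonneg _ := le_rfl
  lt_one _ := zero_lt_one
  summable := summable_zero
  bad_left _ _ _ := by simp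
  bad_right _ _ _ := by simp

variable {d : ℕ} (M : Fin d → ℕ) [hM : ∀ μ, NeZero (M μ)]

/-- The dressed Boltzmann factor is positive. [folklore] -/
theorem integrand_pos (Δ : Matrix (Tor M) (Tor M) ℝ) (W : (Tor M → ℝ) → ℝ) (t : ℝ) (φ : Tor M → ℝ) :
    0 < Real.exp (-(φ ⬝ᵥ (Δ *ᵥ φ) / 2)) * Real.exp (t * W φ) :=
  mul_pos (Real.exp_pos _) (Real.exp_pos _)

/-- The dressed Boltzmann factor of a nonnegative form and a bounded measurable observable is integrable on the small-field box (bounded by `e^{|t|B}`). [folklore] -/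
theorem integrable_integrand {Δ : Matrix (Tor M) (Tor M) ℝ} (hΔ : ∀ φ, 0 ≤ φ ⬝ᵥ (Δ *ᵥ φ)) {W : (Tor M → ℝ) → ℝ} {B : ℝ} (hWm : Measurable W)
    (hWb : ∀ φ, |W φ| ≤ B) (t R : ℝ) :
    Integrable (fun φ => Real.exp (-(φ ⬝ᵥ (Δ *ᵥ φ) / 2)) * Real.exp (t * W φ))
      ((volume : Measure (Tor M → ℝ)).restrict {φ : Tor M → ℝ | ∀ x, |φ x| ≤ R}) := by
  haveI : IsFiniteMeasure ((volume : Measure (Tor M → ℝ)).restrict {φ : Tor M → ℝ | ∀ x, |φ x| ≤ R}) :=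
    isFiniteMeasure_restrict.2 (volume_smallField_lt_top M R).ne
  have hm : Measurable fun φ : Tor M → ℝ => Real.exp (-(φ ⬝ᵥ (Δ *ᵥ φ) / 2)) * Real.exp (t * W φ) :=
    (Real.measurable_exp.comp ((measurable_dotProduct_mulVec M Δ).div_const 2).neg).mul (Real.measurable_exp.comp (measurable_const.mul hWm))
  refine (integrable_const (Real.exp (|t| * B))).mono' hm.aestronglyMeasurable (Eventually.of_forall fun φ => ?_)
  rw [Real.norm_eq_abs, abs_of_pos (integrand_pos M Δ W t φ)]
  have h1 : Real.exp (-(φ ⬝ᵥ (Δ *ᵥ φ) / 2)) ≤ 1 := Real.exp_le_one_iff.2 (by linarith [hΔ φ])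
  have h2 : Real.exp (t * W φ) ≤ Real.exp (|t| * B) := Real.exp_le_exp.2 <| by
    calc t * W φ ≤ |t * W φ| := le_abs_self _
      _ = |t| * |W φ| := abs_mul _ _
      _ ≤ |t| * B := mul_le_mul_of_nonneg_left (hWb φ) (abs_nonneg _)
  calc Real.exp (-(φ ⬝ᵥ (Δ *ᵥ φ) / 2)) * Real.exp (t * W φ) ≤ 1 * Real.exp (|t| * B) :=
        mul_le_mul h1 h2 (Real.exp_pos _).le zero_le_one
    _ = Real.exp (|t| * B) := one_mul _

/-- The small-field box of a POSITIVE radius has positive volume. [folklore] -/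
theorem volume_smallField_pos {R : ℝ} (hR : 0 < R) : 0 < volume {φ : Tor M → ℝ | ∀ x, |φ x| ≤ R} := by
  rw [smallField_eq_Icc M R, Real.volume_Icc_pi]
  exact pos_iff_ne_zero.2 (Finset.prod_ne_zero_iff.2 fun _ _ => (ENNReal.ofReal_pos.2 (by linarith)).ne')

/-- **THE DRESSED SMALL-FIELD PARTITION FUNCTION IS POSITIVE** (positive integrand on a box of positive volume). [folklore] -/
theorem dressedZ_pos {Δ : Matrix (Tor M) (Tor M) ℝ} (hΔ : ∀ φ, 0 ≤ φ ⬝ᵥ (Δ *ᵥ φ)) {W : (Tor M → ℝ) → ℝ} {B : ℝ} (hWm : Measurable W) (hWb : ∀ φ, |W φ| ≤ B)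
    (t : ℝ) {R : ℝ} (hR : 0 < R) :
    0 < ∫ φ in {φ : Tor M → ℝ | ∀ x, |φ x| ≤ R}, Real.exp (-(φ ⬝ᵥ (Δ *ᵥ φ) / 2)) * Real.exp (t * W φ) := by
  rw [integral_pos_iff_support_of_nonneg_ae (Eventually.of_forall fun φ => (integrand_pos M Δ W t φ).le) (integrable_integrand M hΔ hWm hWb t R)]
  have hsupp : Function.support (fun φ : Tor M → ℝ => Real.exp (-(φ ⬝ᵥ (Δ *ᵥ φ) / 2)) * Real.exp (t * W φ)) = Set.univ :=
    Set.eq_univ_of_forall fun φ => (integrand_pos M Δ W t φ).ne'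
  rw [hsupp, Measure.restrict_apply MeasurableSet.univ, Set.univ_inter]
  exact volume_smallField_pos M hR

end Weights

/-! ## §2 `Core` for consecutive King runs: run B IS run A one level up -/
section Consecutive

variable {d : ℕ} (M : Fin d → ℕ) [hM : ∀ μ, NeZero (M μ)] {l₀ vol B R : ℝ} {W : (Tor M → ℝ) → ℝ} {Z : ℕ → ℝ → ℝ} {δ : ℕ → ℝ}

/-- **`Core` FOR CONSECUTIVE KING RUNS ON THE SMALL-FIELD CLASSES** [folklore ∘ `KingModelDensTorus`]: with `Z K t` the dressed small-field partition function after `K + 1` averaging steps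
(one class per level, no large-field classes), `Spine.NE7.Core l₀ vol (univ) (∅) (Z K) (Z (K+1)) δ` as soon as `vol·δ_K ≥ θ_{K+1}·a·R²|Tor M|/2` — run B = run A one level up
(`L^{K+2} = L·L^{K+1}`, `abs_action_sub_le_torus_of_eq` with `n = 1`). -/
theorem core_kingSmallField_consecutive {a : ℝ} (ha : 0 < a) {L : ℕ} [NeZero L] (hL : 2 ≤ L) {m2 : ℝ} (hm : 0 < m2) (hB : 0 ≤ B) (hWm : Measurable W)
    (hWb : ∀ φ, |W φ| ≤ B)
    (hZ : ∀ K (t : ℝ), Z K t = ∫ φ in {φ : Tor M → ℝ | ∀ x, |φ x| ≤ R},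
      Real.exp (-(φ ⬝ᵥ (effLaplacian (L ^ (K + 1)) M (aK a L (K + 1)) (((L ^ (K + 1) : ℕ) : ℝ) ^ 2) m2 *ᵥ φ) / 2)) * Real.exp (t * W φ))
    (hδ : ∀ K, thetaK a L (K + 1) 1 * a * (R ^ 2 * Fintype.card (Tor M)) / 2 ≤ vol * δ K) :
    Core l₀ vol (fun _ => (Finset.univ : Finset Unit)) (fun _ _ => ∅) (fun K t _ => Z K t) (fun K t _ => Z (K + 1) t) δ := by
  have hL1 : (1 : ℝ) < L := by exact_mod_cast hL
  have hL0 : L ≠ 0 := NeZero.ne L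
  have hNk : ∀ K, 1 ≤ L ^ (K + 1) := fun K => Nat.one_le_pow _ L (Nat.pos_of_ne_zero hL0)
  refine core_of_actionBound (ι := Unit) (μ := fun _ _ => (volume : Measure (Tor M → ℝ)).restrict {φ : Tor M → ℝ | ∀ x, |φ x| ≤ R}) (W := fun _ => W)
    (SA := fun K φ => φ ⬝ᵥ (effLaplacian (L ^ (K + 1)) M (aK a L (K + 1)) (((L ^ (K + 1) : ℕ) : ℝ) ^ 2) m2 *ᵥ φ) / 2)
    (SB := fun K φ => φ ⬝ᵥ (effLaplacian (L ^ (K + 1 + 1)) M (aK a L (K + 1 + 1)) (((L ^ (K + 1 + 1) : ℕ) : ℝ) ^ 2) m2 *ᵥ φ) / 2)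
    (r := fun K => thetaK a L (K + 1) 1 * a * (R ^ 2 * Fintype.card (Tor M)) / 2)
    (fun K => (measurable_dotProduct_mulVec M _).div_const 2) (fun K => (measurable_dotProduct_mulVec M _).div_const 2)
    (fun K φ => div_nonneg (dotProduct_effLaplacian_nonneg M (L ^ (K + 1)) (hNk K) (aK_pos ha hL1 (by omega)) hm φ) two_pos.le)
    (fun K φ => div_nonneg (dotProduct_effLaplacian_nonneg M (L ^ (K + 1 + 1)) (hNk (K + 1)) (aK_pos ha hL1 (by omega)) hm φ) two_pos.le)
    (fun K t _ τ _ => (ae_dotProduct_le_smallField M R).mono fun φ hφ => ?_)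
    (fun _ _ _ => isFiniteMeasure_restrict.2 (volume_smallField_lt_top M R).ne) hB (fun _ => hWm) (fun _ => hWb)
    (fun K t _ _ => hZ K t) (fun K t _ _ => hZ (K + 1) t) hδ
  refine (abs_action_sub_le_torus_of_eq M ha hL (k := K + 1) (n := 1) (by omega) le_rfl hm (L ^ (K + 1 + 1)) (by rw [pow_one, pow_succ, mul_comm]) (K + 1 + 1)
    rfl φ).trans ?_
  have : thetaK a L (K + 1) 1 * a * (φ ⬝ᵥ φ) ≤ thetaK a L (K + 1) 1 * a * (R ^ 2 * Fintype.card (Tor M)) :=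
    mul_le_mul_of_nonneg_left hφ (mul_nonneg (kingTheta_nonneg ha hL (by omega) le_rfl) ha.le)
  linarith

end Consecutive

/-! ## §3 The spine's NE7 assembly inhabited; NE7 and the Cauchy property of the generating functions in King's model -/
section Cauchy

variable {d : ℕ} (M : Fin d → ℕ) [hM : ∀ μ, NeZero (M μ)] {l₀ vol B R : ℝ} {W : (Tor M → ℝ) → ℝ} {Z : ℕ → ℝ → ℝ}

/-- **★★ THE NE7 ASSEMBLY OF RECORD, INHABITED BY KING'S SMALL-FIELD MODEL** [folklore ∘ §1–§2 + `T4MatchingAssembly.hybridNE7_noShell`]: one class per level, no large-field classes,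
no shells, `Core` from DENS_cl⁰, and the GEOMETRIC remainder `δ_K = θ_{K+1}·a·R²|Tor M|/(2vol)` (summable, `KingModelDens.summable_kingRadius`):
`HybridNE7 l₀ vol (univ) (Z K) (Z (K+1)) (∅) 0 0 0 0 δ`. -/
theorem hybridNE7_kingSmallField {a : ℝ} (ha : 0 < a) {L : ℕ} [NeZero L] (hL : 2 ≤ L) {m2 : ℝ} (hm : 0 < m2) (hvol : 0 < vol) (hR : 0 < R) (hB : 0 ≤ B)
    (hWm : Measurable W) (hWb : ∀ φ, |W φ| ≤ B)
    (hZ : ∀ K (t : ℝ), Z K t = ∫ φ in {φ : Tor M → ℝ | ∀ x, |φ x| ≤ R},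
      Real.exp (-(φ ⬝ᵥ (effLaplacian (L ^ (K + 1)) M (aK a L (K + 1)) (((L ^ (K + 1) : ℕ) : ℝ) ^ 2) m2 *ᵥ φ) / 2)) * Real.exp (t * W φ)) :
    HybridNE7 l₀ vol (fun _ => (Finset.univ : Finset Unit)) (fun K t _ => Z K t) (fun K t _ => Z (K + 1) t) (fun _ _ => ∅) (fun _ => 0)
      (fun _ _ _ => 0) (fun _ _ _ => 0) (fun _ => 0) fun K => thetaK a L (K + 1) 1 * a * (R ^ 2 * Fintype.card (Tor M)) / 2 / vol := by
  have hL1 : (1 : ℝ) < L := by exact_mod_cast hL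
  have hL0 : L ≠ 0 := NeZero.ne L
  have hNk : ∀ K, 1 ≤ L ^ (K + 1) := fun K => Nat.one_le_pow _ L (Nat.pos_of_ne_zero hL0)
  have hZ0 : ∀ K t, 0 ≤ Z K t := fun K t => by
    rw [hZ K t]
    exact (dressedZ_pos M (fun φ => dotProduct_effLaplacian_nonneg M (L ^ (K + 1)) (hNk K) (aK_pos ha hL1 (by omega)) hm φ) hWm hWb t hR).le
  refine hybridNE7_noShell relWeightBound_empty (fun K t _ _ _ => hZ0 K t) (fun K t _ _ _ => hZ0 (K + 1) t)
    ((summable_kingRadius ha hL le_rfl (M := R ^ 2 * Fintype.card (Tor M)) (by positivity) B).1.div_const vol) ?_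
  exact core_kingSmallField_consecutive M ha hL hm hB hWm hWb hZ fun K => le_of_eq (by field_simp)

/-- **★★★ NE7 AND THE CAUCHY PROPERTY OF THE GENERATING FUNCTIONS IN KING'S SMALL-FIELD MODEL** [folklore ∘ `hybridNE7_kingSmallField` + `HybridNE7.cauchy`]: for `vol > 0`, `l₀ ≥ 0`,
`R > 0` and ONE bounded measurable unit-scale observable `W`, the dressed small-field partition functions `Z K t` (run length `K`, `K + 1` averaging steps) satisfy N19's target
`MatchingModConstants vol l₀ δ Z` with the SUMMABLE geometric `δ_K = θ_{K+1}·a·R²|Tor M|/(2vol)`, and the generating functions `genFun Z K t = log Z_K(t) − log Z_K(0)` are CAUCHY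
in `K` for every `|t| ≤ l₀`, converging uniformly on the window to `genFunLim Z` — the apex's statement, IN THE PRINTED MODEL. -/
theorem cauchy_genFun_kingSmallField {a : ℝ} (ha : 0 < a) {L : ℕ} [NeZero L] (hL : 2 ≤ L) {m2 : ℝ} (hm : 0 < m2) (hvol : 0 < vol) (hl₀ : 0 ≤ l₀) (hR : 0 < R)
    (hB : 0 ≤ B) (hWm : Measurable W) (hWb : ∀ φ, |W φ| ≤ B)
    (hZ : ∀ K (t : ℝ), Z K t = ∫ φ in {φ : Tor M → ℝ | ∀ x, |φ x| ≤ R},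
      Real.exp (-(φ ⬝ᵥ (effLaplacian (L ^ (K + 1)) M (aK a L (K + 1)) (((L ^ (K + 1) : ℕ) : ℝ) ^ 2) m2 *ᵥ φ) / 2)) * Real.exp (t * W φ)) :
    MatchingModConstants vol l₀ (fun K => thetaK a L (K + 1) 1 * a * (R ^ 2 * Fintype.card (Tor M)) / 2 / vol) Z ∧
      (Summable fun K => thetaK a L (K + 1) 1 * a * (R ^ 2 * Fintype.card (Tor M)) / 2 / vol) ∧
      (∀ t : ℝ, |t| ≤ l₀ → CauchySeq fun K => genFun Z K t) ∧
      TendstoUniformlyOn (fun K t => genFun Z K t) (genFunLim Z) atTop {t | |t| ≤ l₀} := by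
  have hL1 : (1 : ℝ) < L := by exact_mod_cast hL
  have hL0 : L ≠ 0 := NeZero.ne L
  have hNk : ∀ K, 1 ≤ L ^ (K + 1) := fun K => Nat.one_le_pow _ L (Nat.pos_of_ne_zero hL0)
  have h := (hybridNE7_kingSmallField M ha hL hm hvol hR hB hWm hWb hZ).cauchy (Z := Z) hvol hl₀ (fun K t _ => by simp) (fun K t _ => by simp) fun K t _ => by
    rw [Finset.sum_const, Finset.card_univ, Fintype.card_unit, one_smul, hZ K t]
    exact dressedZ_pos M (fun φ => dotProduct_effLaplacian_nonneg M (L ^ (K + 1)) (hNk K) (aK_pos ha hL1 (by omega)) hm φ) hWm hWb t hR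
  have hδ : hybridDelta vol (fun K => thetaK a L (K + 1) 1 * a * (R ^ 2 * Fintype.card (Tor M)) / 2 / vol) (fun K => (0 : ℝ) + 0)
      = fun K => thetaK a L (K + 1) 1 * a * (R ^ 2 * Fintype.card (Tor M)) / 2 / vol := by
    funext K
    simp [hybridDelta]
  rw [hδ] at h
  exact h

end Cauchy

end YMDAG.N18.KingModelCauchy

end
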